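import Mathlib.Analysis.Complex.Basic
import Mathlib.Order.Hom.Basic
import Mathlib.Order.Fin.Basic
import Literature.Probability.RandomPlanarGeometry.PlanarDomains
import Literature.Probability.RandomPlanarGeometry.ConformalMap
import HarnessLib

-- provenance: harness21/H21/H21/Prelude/Stoch/ConformalRectangle.lean @ 6f9f43a (interim HEAD d8f2665); M5 mechanical rewrite
/-!
# Cross-ratios and uniformizing maps of marked Jordan domains (trunk `Stoch`)

This prelude file provides the conformal modulus data of marked Jordan domains used by the
Cardy–Smirnov crossing formula and by chordal SLE:

* `Literature.crossRatio x`: Cardy's cross-ratio `η = (x₀ - x₁)(x₂ - x₃) / ((x₀ - x₂)(x₁ - x₃))` of four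
  real points; for a monotone (or antitone) tuple `η ∈ (0, 1)` (`crossRatio_mem_Ioo`), and `η` is
  invariant under reversal, negation and real affine maps (`crossRatio_rev`, `crossRatio_neg`,
  `crossRatio_affine`), all proved.
* `Literature.MarkedDomain.IsUniformizing D φ x`: `φ : ℍₒ → D` is a conformal equivalence whose boundary
  values at the (monotone or antitone) real points `x i` are the marked points `D.pt i`; existence
  (`MarkedDomain.exists_isUniformizing`, Riemann mapping + Carathéodory) and, for conformal
  rectangles, independence of the cross-ratio (`ConformalRectangle.crossRatio_eq_of_isUniformizing`)
  are sorried theorems with citations.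
* `Literature.MarkedDomain.IsChordalUniformizing D φ` (`D` a Dobrushin domain): `φ : ℍₒ → D` with
  `0 ↦ pt 0`, `∞ ↦ pt 1`; existence and uniqueness up to the dilations `z ↦ c z` of `ℍₒ`.
* The statement combinator `Literature.ConformalRectangle.HasCrossingLimit R p F`: the crossing
  probabilities `p δ` converge, as the mesh `δ → 0⁺`, to `F (crossRatio x)` for every uniformizing
  datum `(φ, x)` of `R`.

## Mathlib

We USE `UpperHalfPlane.upperHalfPlaneSet` (notation `ℍₒ`), `StrictMono` / `StrictAnti`, `Fin.rev`,
`Filter.Tendsto`, `𝓝[>]`. Mathlib has no cross-ratio of four real (or complex) points and no notion of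
uniformizing map of a marked domain (searched `crossRatio`, `cross.?ratio`).

## Design choices

* ONE uniformizing direction `ℍₒ → Ω` for all uniformizing maps (outline D5).
* No choice-valued `modulus`: statements quantify over uniformizing data `(φ, x)`; this is
  non-vacuous by `exists_isUniformizing` and well defined by `crossRatio_eq_of_isUniformizing`.
* Both `StrictMono x` and `StrictAnti x` are allowed since the orientation of the boundary loop of a
  `JordanDomain` is not encoded (outline D4); `crossRatio_rev` shows `η` does not see the difference.
* Uniqueness of chordal uniformizing maps is stated as `EqOn` on `ℍₒ` (not as equality of
  `ConformalEquiv` structures, which carry junk values outside `ℍₒ` and would make the statement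
  false), exactly as for `existsUnique_conformalEquiv_ball` in `ConformalMap`.

## References

* S. Smirnov, *Critical percolation in the plane: conformal invariance, Cardy's formula, scaling
  limits*, C. R. Acad. Sci. Paris Sér. I Math. 333 (2001), 239–244.
* W. Werner, *Lectures on two-dimensional critical percolation*, IAS/Park City (2007), §2–3.
* G. F. Lawler, *Conformally Invariant Processes in the Plane*, AMS (2005), Ch. 6.
* L. V. Ahlfors, *Complex Analysis*, 3rd ed. (1979), Ch. 3 §3 (cross-ratio, linear transformations).
-/

open Set Filter Topology Complex
open UpperHalfPlane (upperHalfPlaneSet isOpen_upperHalfPlaneSet)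

noncomputable section

namespace Literature.Probability.RandomPlanarGeometry

/-! ### Cardy's cross-ratio -/

/-- **Cardy's cross-ratio** of four real points `x₀, x₁, x₂, x₃`:
`η = (x₀ - x₁)(x₂ - x₃) / ((x₀ - x₂)(x₁ - x₃))`. For `x₀ < x₁ < x₂ < x₃` one has `η ∈ (0, 1)`,
`η → 0` as `x₁ → x₀` and `η → 1` as the arc `(x₃ x₀)` through `∞` degenerates; the Cardy–Smirnov
crossing probability between the arcs `(x₀x₁)` and `(x₂x₃)` of `ℍₒ` is `F(η)`. Junk value `0` when
the denominator vanishes (division by zero). Smirnov, C. R. Acad. Sci. 333 (2001); Werner (2007), §3;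
Ahlfors (1979), Ch. 3 §3.1. [cite: Werner2007] -/
def crossRatio (x : Fin 4 → ℝ) : ℝ :=
  (x 0 - x 1) * (x 2 - x 3) / ((x 0 - x 2) * (x 1 - x 3))

/-- For a strictly monotone or strictly antitone tuple the cross-ratio lies in `(0, 1)`
(Werner 2007, §3; Ahlfors 1979, Ch. 3 §3.1). [cite: Werner2007, §3] -/
theorem crossRatio_mem_Ioo {x : Fin 4 → ℝ} (h : StrictMono x ∨ StrictAnti x) :
    crossRatio x ∈ Ioo 0 1 := by
  have h01 : (0 : Fin 4) < 1 := by decide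
  have h12 : (1 : Fin 4) < 2 := by decide
  have h23 : (2 : Fin 4) < 3 := by decide
  unfold crossRatio
  rcases h with h | h
  · have a := h h01; have b := h h12; have c := h h23
    have hd : 0 < (x 0 - x 2) * (x 1 - x 3) := by nlinarith
    refine ⟨div_pos (by nlinarith) hd, (div_lt_one hd).2 (by nlinarith)⟩
  · have a := h h01; have b := h h12; have c := h h23
    have hd : 0 < (x 0 - x 2) * (x 1 - x 3) := by nlinarith
    refine ⟨div_pos (by nlinarith) hd, (div_lt_one hd).2 (by nlinarith)⟩

/-- The cross-ratio is invariant under reversing the order of the four points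
(`(x₃, x₂, x₁, x₀)`), reflecting that the orientation of the boundary is irrelevant
(Ahlfors 1979, Ch. 3 §3.1). [cite: Ahlfors1979, Ch. 3 §3.1] -/
theorem crossRatio_rev (x : Fin 4 → ℝ) : crossRatio (x ∘ Fin.rev) = crossRatio x := by
  simp only [crossRatio, Function.comp_apply]
  have h0 : Fin.rev (0 : Fin 4) = 3 := by decide
  have h1 : Fin.rev (1 : Fin 4) = 2 := by decide
  have h2 : Fin.rev (2 : Fin 4) = 1 := by decide
  have h3 : Fin.rev (3 : Fin 4) = 0 := by decide
  rw [h0, h1, h2, h3]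
  ring

/-- The cross-ratio is invariant under `x ↦ -x` (Ahlfors 1979, Ch. 3 §3.1). [cite: Ahlfors1979, Ch. 3 §3.1] -/
theorem crossRatio_neg (x : Fin 4 → ℝ) : crossRatio (-x) = crossRatio x := by
  simp only [crossRatio, Pi.neg_apply]
  ring

/-- The cross-ratio is invariant under real affine maps `t ↦ a t + b`, `a ≠ 0` (in particular under
the dilations and translations of `ℍₒ`) (Ahlfors 1979, Ch. 3 §3.1). [cite: Ahlfors1979, Ch. 3 §3.1] -/
theorem crossRatio_affine (x : Fin 4 → ℝ) {a : ℝ} (ha : a ≠ 0) (b : ℝ) :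
    crossRatio (fun i ↦ a * x i + b) = crossRatio x := by
  simp only [crossRatio]
  have h1 : (a * x 0 + b - (a * x 1 + b)) * (a * x 2 + b - (a * x 3 + b)) =
      a ^ 2 * ((x 0 - x 1) * (x 2 - x 3)) := by ring
  have h2 : (a * x 0 + b - (a * x 2 + b)) * (a * x 1 + b - (a * x 3 + b)) =
      a ^ 2 * ((x 0 - x 2) * (x 1 - x 3)) := by ring
  rw [h1, h2, mul_div_mul_left _ _ (pow_ne_zero 2 ha)]

/-! ### Uniformizing maps of marked domains -/

namespace MarkedDomain

variable {n : ℕ}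

/-- `φ : ℍₒ → D` is a **uniformizing map** of the marked domain `D` with (finite, real) boundary
preimages `x : Fin n → ℝ` of the marked points: `x` is strictly monotone or strictly antitone (the
orientation of `∂D` is not encoded) and `φ` has boundary value `D.pt i` at `x i` for every `i`.
For a conformal rectangle this says `φ` maps `(ℍₒ; x₀, x₁, x₂, x₃)` onto `(D; a, b, c, d)`.
Smirnov (2001); Werner (2007), §3; Lawler (2005), Ch. 6. [cite: Smirnov2001] -/
def IsUniformizing (D : MarkedDomain n) (φ : ConformalEquiv upperHalfPlaneSet D.carrier)
    (x : Fin n → ℝ) : Prop :=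
  (StrictMono x ∨ StrictAnti x) ∧ ∀ i, φ.HasBoundaryValue (x i) (D.pt i)

/-- The boundary preimages of a uniformizing map are strictly monotone or strictly antitone. [folklore] -/
theorem IsUniformizing.strictMono_or_strictAnti {D : MarkedDomain n}
    {φ : ConformalEquiv upperHalfPlaneSet D.carrier} {x : Fin n → ℝ} (h : D.IsUniformizing φ x) :
    StrictMono x ∨ StrictAnti x :=
  h.1

/-- A uniformizing map has boundary value the `i`-th marked point at `x i`. [folklore] -/
theorem IsUniformizing.hasBoundaryValue {D : MarkedDomain n}
    {φ : ConformalEquiv upperHalfPlaneSet D.carrier} {x : Fin n → ℝ} (h : D.IsUniformizing φ x)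
    (i : Fin n) : φ.HasBoundaryValue (x i) (D.pt i) :=
  h.2 i

/-- The boundary preimages of a uniformizing map are pairwise distinct. [folklore] -/
theorem IsUniformizing.injective {D : MarkedDomain n}
    {φ : ConformalEquiv upperHalfPlaneSet D.carrier} {x : Fin n → ℝ} (h : D.IsUniformizing φ x) :
    Function.Injective x :=
  h.1.elim StrictMono.injective StrictAnti.injective

/-- **Existence of uniformizing maps**: every marked Jordan domain admits a conformal equivalence
`φ : ℍₒ → D` under which all marked points have finite real boundary preimages, in monotone order.
Proof sketch: Riemann mapping theorem (`exists_conformalEquiv_upperHalfPlaneSet`, using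
`JordanDomain.isSimplyConnected`), Carathéodory's boundary correspondence
(`JordanDomain.existsUnique_real_or_infty`), and precomposition with a Möbius self-map of `ℍₒ`
moving `∞` off the finitely many marked preimages. Ahlfors (1979), Ch. 6 §1.1; Pommerenke (1992),
Thm 2.6; Werner (2007), §3. [cite: Ahlfors1979] -/
def exists_isUniformizing : Prop :=
  ∀ (D : MarkedDomain n),
    ∃ (φ : ConformalEquiv upperHalfPlaneSet D.carrier) (x : Fin n → ℝ), D.IsUniformizing φ x

end MarkedDomain

namespace ConformalRectangle

/-- **Conformal invariance of the cross-ratio**: any two uniformizing data `(φ, x)`, `(φ', x')` of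
the same conformal rectangle have the same cross-ratio, since `φ⁻¹ ∘ φ'` is a Möbius self-map of
`ℍₒ` (possibly composed with the order reversal, cf. `crossRatio_rev`) carrying `x'` to `x`. Hence
`crossRatio x` is the conformal modulus of `R`. Ahlfors (1979), Ch. 3 §3.1 and Ch. 6 §1.1;
Werner (2007), §3. [cite: Ahlfors1979] -/
def crossRatio_eq_of_isUniformizing : Prop :=
  ∀ {R : ConformalRectangle} {φ φ' : ConformalEquiv upperHalfPlaneSet R.carrier} {x x' : Fin 4 → ℝ} (h : R.IsUniformizing φ x) (h' : R.IsUniformizing φ' x'),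
    crossRatio x = crossRatio x'

/-- The cross-ratio of any uniformizing datum of a conformal rectangle lies in `(0, 1)`. [folklore] -/
theorem crossRatio_mem_Ioo_of_isUniformizing {R : ConformalRectangle}
    {φ : ConformalEquiv upperHalfPlaneSet R.carrier} {x : Fin 4 → ℝ} (h : R.IsUniformizing φ x) :
    crossRatio x ∈ Ioo 0 1 :=
  crossRatio_mem_Ioo h.1

/-- Statement combinator: the conformal rectangle `R` **has crossing limit** `F` for the family
`p : ℝ → ℝ` (`p δ` = crossing probability of `R` at mesh `δ`) if `p δ → F η` as `δ → 0⁺`, where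
`η = crossRatio x` for every uniformizing datum `(φ, x)` of `R` (non-vacuous by
`MarkedDomain.exists_isUniformizing`, independent of the datum by `crossRatio_eq_of_isUniformizing`).
Cardy's formula is `R.HasCrossingLimit p cardyFunction`. Smirnov, C. R. Acad. Sci. 333 (2001),
Thm 1; Werner (2007), §3. [cite: Werner2007] -/
def HasCrossingLimit (R : ConformalRectangle) (p : ℝ → ℝ) (F : ℝ → ℝ) : Prop :=
  ∀ (φ : ConformalEquiv upperHalfPlaneSet R.carrier) (x : Fin 4 → ℝ), R.IsUniformizing φ x →
    Tendsto p (𝓝[>] 0) (𝓝 (F (crossRatio x)))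

end ConformalRectangle

/-! ### Chordal uniformizing maps of Dobrushin domains -/

namespace MarkedDomain

/-- `φ : ℍₒ → D` is a **chordal uniformizing map** of the Dobrushin domain `(D; a, b)`: `φ` has
boundary value `a = pt 0` at `0` and `b = pt 1` at `∞`. This is the normalisation used to define
chordal SLE in `(D; a, b)` as the image of chordal SLE in `(ℍₒ; 0, ∞)`. Lawler (2005), Ch. 6;
Werner (2007), §2. [cite: Lawler2005] -/
def IsChordalUniformizing (D : MarkedDomain 2) (φ : ConformalEquiv upperHalfPlaneSet D.carrier) :
    Prop :=
  φ.HasBoundaryValue 0 (D.pt 0) ∧ φ.HasBoundaryValueAtInfty (D.pt 1)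

/-- **Existence of chordal uniformizing maps**: every Dobrushin domain `(D; a, b)` is the image of
`(ℍₒ; 0, ∞)` under a conformal equivalence with the prescribed boundary values (Riemann mapping +
Carathéodory + a Möbius self-map of `ℍₒ`; three real parameters fix two boundary points with one
to spare). Ahlfors (1979), Ch. 6 §1.1; Pommerenke (1992), Thm 2.6; Lawler (2005), Ch. 6. [cite: Ahlfors1979] -/
def exists_isChordalUniformizing : Prop :=
  ∀ (D : DobrushinDomain),
    ∃ φ : ConformalEquiv upperHalfPlaneSet D.carrier, D.IsChordalUniformizing φ

/-- **Uniqueness of chordal uniformizing maps up to dilation**: two chordal uniformizing maps of the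
same Dobrushin domain differ by a dilation `z ↦ c z` (`c > 0`) of `ℍₒ`, the only Möbius self-maps
of `ℍₒ` fixing `0` and `∞`; this is the source of the scale-invariance requirement on chordal SLE.
Stated as `EqOn` on `ℍₒ` (a `ConformalEquiv` carries junk values outside its source).
Lawler (2005), Ch. 6, §6.1; Werner (2007), §2. [cite: Lawler2005] -/
def IsChordalUniformizing.exists_eq_trans_smul : Prop :=
  ∀ {D : MarkedDomain 2} {φ φ' : ConformalEquiv upperHalfPlaneSet D.carrier} (h : D.IsChordalUniformizing φ) (h' : D.IsChordalUniformizing φ'),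
    ∃ (c : ℝ) (hc : 0 < c),
      EqOn φ' ((ConformalEquiv.smulUpperHalfPlane c hc).trans φ) upperHalfPlaneSet

/-- Conversely, precomposing a chordal uniformizing map with a dilation of `ℍₒ` gives a chordal
uniformizing map (dilations fix `0` and `∞`). Lawler (2005), Ch. 6. [cite: Lawler2005] -/
theorem IsChordalUniformizing.smul_trans {D : MarkedDomain 2}
    {φ : ConformalEquiv upperHalfPlaneSet D.carrier} (h : D.IsChordalUniformizing φ) (c : ℝ)
    (hc : 0 < c) : D.IsChordalUniformizing ((ConformalEquiv.smulUpperHalfPlane c hc).trans φ) := by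
  have hmaps : MapsTo (fun z : ℂ ↦ c • z) upperHalfPlaneSet upperHalfPlaneSet :=
    (ConformalEquiv.smulUpperHalfPlane c hc).mapsTo
  have hcont : Continuous fun z : ℂ ↦ c • z := continuous_const_smul c
  refine ⟨?_, ?_⟩
  · have h0 : Tendsto (fun z : ℂ ↦ c • z) (𝓝[upperHalfPlaneSet] 0) (𝓝[upperHalfPlaneSet] 0) := by
      simpa using (hcont.continuousWithinAt (x := 0)).tendsto_nhdsWithin hmaps
    exact h.1.comp h0
  · have h1 : Tendsto (fun z : ℂ ↦ c • z) (cocompact ℂ) (cocompact ℂ) := by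
      have := (Homeomorph.smulOfNeZero c hc.ne' : ℂ ≃ₜ ℂ).map_cocompact
      exact this.le
    have h2 : Tendsto (fun z : ℂ ↦ c • z) (cocompact ℂ ⊓ 𝓟 upperHalfPlaneSet)
        (cocompact ℂ ⊓ 𝓟 upperHalfPlaneSet) :=
      h1.inf (tendsto_principal_principal.2 hmaps)
    exact h.2.comp h2

end MarkedDomain

end Literature.Probability.RandomPlanarGeometry
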